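import Mathlib
import Summits.NavierStokesRegularity.NavierStokesRegularity.Theorems.EulerZoomLiouvillePowerGaugeEulerLiouvilleDSSEndpointSobolevSliceShell
import Summits.NavierStokesRegularity.NavierStokesRegularity.Theorems.EulerZoomLiouvillePowerGaugeEulerLiouvilleDSSEndpointSobolevSupFlux
import Summits.NavierStokesRegularity.NavierStokesRegularity.Theorems.EulerZoomLiouvillePowerGaugeEulerLiouvilleSelfSimilarEndpointSobolevIteration
import HarnessLib

/-!
# Rung C2 of the crux `EulerZoomLiouville.PowerGaugeEulerLiouville` at the endpoint `ρ = 1/2`: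
# GROWTH-FREE drain `L^{−5/2+ε}` of the SLICE-WISE shell energies of DSS members (weak class)

Route №10 `EulerZoomLiouville` (NavierStokesRegularity), crux E = stmt-NavierStokesRegularity-19832,
stub `stub_nonSelfSimilarRest` (DSS endpoint stratum `IsDSSPowerSpread`).  This seat's F-d
(`dss_half_periodEnergy_decay_of_weakGradient`, `…DSSEndpointSobolevDecay`) drained the PERIOD-INTEGRATED
shell energies of a DSS endpoint member at the rate `L^{−5/6+ε}`: with `S` = period-integrated window energy,
Hölder in time caps the window power at `1/4`.  Measuring the window instead by the ESSENTIAL SUPREMUM over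
the period of the slice shell energies, `f(L) = ess sup_{τ∈I₀} ∫_{L≤|y|<2L} |u(τ)|²`, the slice-wise shell
inequality (`dss_half_aeSliceShell_le`) and the sup-form period flux (`period_flux_le_of_weakGradient_sup`)
give the recursion of the CENTRED endpoint drain, `f(L) ≤ C₁ L^{−5/8} S(L)^{3/4} + C₂ √S(L) L^{−5/2}`,
whose least fixed point is `min((5/8)/(1/4), 5) = 5/2` (`shell_decay_of_recursion_rpow`):

* `EndpointSobolev.dss_half_sliceEnergy_decay_of_weakGradient` — suitable weak Euler pair, DSS with factor
  `l ≥ 4` at `ρ = 1/2`, weak gradient with `a^{1/2}E(a;0;H) ≤ c`, slices of energy `≤ E₀`, `|u|³`, `|p||u|`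
  locally integrable on a.e. slice, the a.e. slice Riesz representation ⇒ for every `ε > 0` a `C` with, for
  `L ≥ 1`, `∫_{L≤|y|<2L} |u(τ)|² ≤ C L^{−5/2+ε}` for a.e. `τ ∈ I₀ = (l^{5/2}τ₀, τ₀)` AND
  `∫_{I₀} ∫_{L≤|y|<2L} |u|² ≤ |I₀| C L^{−5/2+ε}`;
* `EndpointSobolev.dss_half_period_false_of_shellLower_of_weakGradient_sharp` — plus a lower bound
  `c₀ L^{−5+η}`, `η > 5/2` (F-d needed `η > 25/6`), on the period-integrated shell energies along radii beyond
  every bound ⇒ `False`.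

WHAT THIS IS NOT: not NS, not E, not the stub — the growth-free DSS endpoint drain at the centred rate `5/2`;
the `IsDSSPowerSpread` growth-free disjunct may read `η > 5/2`. [cite: ChaeShvydkoy2013, §3.1 Thm. 3.1;
Xue2014DSSEuler, Thm 1.1 (ii)]
-/

noncomputable section

-- flat `Theorems/<Route><Decl>…` files of one crux share the namespace of the crux (tree convention)
set_option linter.dupNamespace false

open MeasureTheory Set Filter Topology Metric Function TopologicalSpace
open scoped ENNReal NNReal InnerProductSpace RealInnerProductSpace

namespace Summit.NavierStokesRegularity.NavierStokesRegularity.Theorems.PowerGaugeEulerLiouville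

open Literature.Analysis Literature.Analysis.FunctionSpaces Literature.Analysis.FluidPDE

namespace EndpointSobolev

section Decay

variable {u : ℝ → EuclideanSpace ℝ (Fin 3) → EuclideanSpace ℝ (Fin 3)}
  {p : ℝ → EuclideanSpace ℝ (Fin 3) → ℝ}
  {H : ℝ → EuclideanSpace ℝ (Fin 3) → EuclideanSpace ℝ (Fin 3) →L[ℝ] EuclideanSpace ℝ (Fin 3)}

/-- **Growth-free slice-wise drain of DSS endpoint members (factor `l ≥ 4`), rate `L^{−5/2+ε}`.**  See the
module docstring (adapted from this seat's `dss_half_periodEnergy_decay_of_weakGradient`, with the essential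
supremum over the period as the recursion variable). [cite: ChaeShvydkoy2013, §3.1 proof of Thm. 3.1] -/
theorem dss_half_sliceEnergy_decay_of_weakGradient {c : ℝ≥0}
    (hsw : IsSuitableWeakSolutionOn (slab (EuclideanSpace ℝ (Fin 3)) (Iio 0) isOpen_Iio) 0 0 u p)
    (hH : HasWeakSpatialGradientOn (slab (EuclideanSpace ℝ (Fin 3)) (Iio 0) isOpen_Iio) u H)
    (hEg : ∀ a : ℝ, 0 < a →
      ENNReal.ofReal (a ^ (1 / 2 : ℝ)) * cknE a (0 : ℝ × EuclideanSpace ℝ (Fin 3)) H ≤ (c : ℝ≥0∞))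
    {l : ℝ} (hl : 4 ≤ l)
    (hu : ∀ τ : ℝ, τ < 0 → ∀ y, u τ y = (l ^ (3 / 2 : ℝ)) • u (l ^ (5 / 2 : ℝ) * τ) (l • y))
    (hp : ∀ τ : ℝ, τ < 0 → ∀ y, p τ y = l ^ 3 * p (l ^ (5 / 2 : ℝ) * τ) (l • y))
    {τ₀ : ℝ} (hτ₀ : τ₀ < 0) {E₀ : ℝ}
    (hE : ∀ᵐ τ : ℝ, τ < 0 → Integrable (fun y => ‖u τ y‖ ^ 2) volume ∧ ∫ y, ‖u τ y‖ ^ 2 ≤ E₀)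
    (h3 : ∀ᵐ τ : ℝ, τ < 0 → LocallyIntegrable (fun y => ‖u τ y‖ ^ 3) volume)
    (hPV : ∀ᵐ τ : ℝ, τ < 0 → LocallyIntegrable (fun y => |p τ y| * ‖u τ y‖) volume)
    {R₁ : ℝ}
    (hPR : ∀ᵐ τ : ℝ, τ ∈ Ioo (l ^ (5 / 2 : ℝ) * τ₀) τ₀ → ∀ R : ℝ, R₁ ≤ R →
      ∀ᵐ y ∂volume, ‖y‖ < R / 2 →
        p τ y = rieszPressure ((ball (0 : EuclideanSpace ℝ (Fin 3)) R).indicator (u τ)) y +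
          ∫ z in {z | R ≤ ‖z‖}, pressureKernel (y - z) (u τ z))
    {ε : ℝ} (hε : 0 < ε) :
    ∃ C : ℝ, ∀ L : ℝ, 1 ≤ L →
      (∀ᵐ τ : ℝ, τ ∈ Ioo (l ^ (5 / 2 : ℝ) * τ₀) τ₀ →
        ∫ y in {y : EuclideanSpace ℝ (Fin 3) | L ≤ ‖y‖ ∧ ‖y‖ < 2 * L}, ‖u τ y‖ ^ 2 ≤
          C * L ^ (-(5 / 2 : ℝ) + ε)) ∧
      ∫ τ in Ioo (l ^ (5 / 2 : ℝ) * τ₀) τ₀,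
          ∫ y in {y : EuclideanSpace ℝ (Fin 3) | L ≤ ‖y‖ ∧ ‖y‖ < 2 * L}, ‖u τ y‖ ^ 2 ≤
        (τ₀ - l ^ (5 / 2 : ℝ) * τ₀) * (C * L ^ (-(5 / 2 : ℝ) + ε)) := by
  -- constants of the member and the period
  have hl0 : 0 < l := by linarith
  have hl1 : 1 < l := by linarith
  set b : ℝ := l ^ (5 / 2 : ℝ) with hb
  have hb1 : 1 < b := Real.one_lt_rpow hl1 (by norm_num)
  have hb0 : 0 < b := by linarith
  have hbτ : b * τ₀ < τ₀ := by
    have := mul_lt_mul_of_neg_right hb1 hτ₀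
    linarith
  set I₀ : Set ℝ := Ioo (b * τ₀) τ₀ with hI₀
  set T : ℝ := τ₀ - b * τ₀ with hT
  have hT0 : 0 < T := by rw [hT]; linarith
  have hTvol : volume.real I₀ = T := Real.volume_real_Ioo_of_le hbτ.le
  have hI₀0 : I₀ ⊆ Iio 0 := fun t ht => ht.2.trans hτ₀
  have hne : (ae ((volume : Measure ℝ).restrict I₀)).NeBot := by
    rw [ae_neBot, Ne, Measure.restrict_eq_zero, hI₀, Real.volume_Ioo, ENNReal.ofReal_eq_zero, not_le]
    linarith
  -- the window width `m`: `2^m ≥ 4l`, `m ≥ 5`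
  obtain ⟨m₀, hm₀⟩ := pow_unbounded_of_one_lt (4 * l) (by norm_num : (1 : ℝ) < 2)
  set m : ℕ := m₀ + 5 with hm
  have h2m : 4 * l ≤ (2 : ℝ) ^ m := by
    rw [hm, pow_add]
    have : (1 : ℝ) ≤ 2 ^ 5 := by norm_num
    nlinarith [hm₀, pow_pos (show (0 : ℝ) < 2 by norm_num) m₀]
  have h2m' : (64 : ℝ) ≤ 2 ^ (m + 1) := by
    rw [hm, show m₀ + 5 + 1 = m₀ + 6 by ring, pow_add]
    have : (1 : ℝ) ≤ 2 ^ m₀ := one_le_pow₀ (by norm_num)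
    nlinarith
  -- measurability, slice energies
  obtain ⟨K, hK0, hK⟩ := dss_half_aeSliceShell_le hsw (by linarith : (2 : ℝ) ≤ l) hu hp hτ₀
  have hum : AEStronglyMeasurable (uncurry u)
      (volume.restrict (Iio (0 : ℝ) ×ˢ (univ : Set (EuclideanSpace ℝ (Fin 3))))) := by
    obtain ⟨G, hG, -, -⟩ := hsw.localEnergy
    simpa [slab] using hG.locallyIntegrableOn.aestronglyMeasurable
  have hW := fun (A : Set (EuclideanSpace ℝ (Fin 3))) (hA : MeasurableSet A) =>
    period_sliceSetEnergy hum hE (α := b * τ₀) hτ₀ hA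
  have hshellm : ∀ A B : ℝ, MeasurableSet {y : EuclideanSpace ℝ (Fin 3) | A ≤ ‖y‖ ∧ ‖y‖ < B} :=
    fun A B => (measurableSet_le measurable_const measurable_norm).inter
      (measurableSet_lt measurable_norm measurable_const)
  have hshellm' : ∀ A B : ℝ, MeasurableSet {y : EuclideanSpace ℝ (Fin 3) | A ≤ ‖y‖ ∧ ‖y‖ ≤ B} :=
    fun A B => (measurableSet_le measurable_const measurable_norm).inter
      (measurableSet_le measurable_norm measurable_const)
  -- the slice shell energies `e L τ` and their essential suprema `f L` over the period
  set e : ℝ → ℝ → ℝ := fun L τ => ∫ y in {y : EuclideanSpace ℝ (Fin 3) | L ≤ ‖y‖ ∧ ‖y‖ < 2 * L},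
    ‖u τ y‖ ^ 2 with he
  set f : ℝ → ℝ := fun L => essSup (e L) (volume.restrict I₀) with hf
  have heb : ∀ L, ∀ᵐ τ ∂(volume.restrict I₀), 0 ≤ e L τ ∧ e L τ ≤ E₀ := fun L =>
    (ae_restrict_iff' measurableSet_Ioo).2 (hW _ (hshellm L (2 * L))).2.1
  have hfa : ∀ L, ∀ᵐ τ : ℝ, τ ∈ I₀ → e L τ ≤ f L := fun L =>
    (ae_restrict_iff' measurableSet_Ioo).1
      (ae_le_essSup (isBoundedUnder_of_eventually_le ((heb L).mono fun τ h => h.2)))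
  have hfle : ∀ L M : ℝ, (∀ᵐ τ : ℝ, τ ∈ I₀ → e L τ ≤ M) → f L ≤ M := fun L M h =>
    essSup_le_of_ae_le M ((ae_restrict_iff' measurableSet_Ioo).2 h)
      (IsBoundedUnder.isCoboundedUnder_le (isBoundedUnder_of_eventually_ge ((heb L).mono fun τ h => h.1)))
  have hf0 : ∀ L, 0 ≤ f L := fun L => by
    obtain ⟨τ, h1, h2⟩ := ((heb L).and ((ae_restrict_iff' measurableSet_Ioo).2 (hfa L))).exists
    exact h1.1.trans h2
  have hf0' : ∀ L, 0 < L → 0 ≤ f L := fun L _ => hf0 L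
  have hfB : ∀ L, 0 < L → f L ≤ E₀ := fun L _ =>
    hfle L E₀ ((ae_restrict_iff' measurableSet_Ioo).1 ((heb L).mono fun τ h => h.2))
  have hE₀ : 0 ≤ E₀ := (hf0 1).trans (hfB 1 one_pos)
  -- the sup-form period flux bounds and the window sum
  obtain ⟨a, bb, ha0, hbb0, hQ⟩ := period_flux_le_of_weakGradient_sup hsw hH hEg hτ₀ hbτ hE h3 hPV hPR
    hf0 (fun L' _ => hfa L') m
  set S : ℝ → ℝ := fun L => ∑ k ∈ Finset.range (2 * m + 1), f (2 ^ k * L / 2 ^ m) with hS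
  -- the recursion
  set C₁ : ℝ := K / 2 * a * ((2 : ℝ) ^ (3 / 8 : ℝ) + l * (2 / l) ^ (3 / 8 : ℝ)) with hC₁
  set C₂ : ℝ := K / 2 * bb * E₀ * T * ((2 : ℝ) ^ (-(3 / 2 : ℝ)) + l * (2 / l) ^ (-(3 / 2 : ℝ)))
    with hC₂
  have hC₁0 : 0 ≤ C₁ := by positivity
  have hC₂0 : 0 ≤ C₂ := by positivity
  set L₁ : ℝ := max 1 (max (l * |R₁|) (max l (l * Real.sqrt (b * -τ₀)))) with hL₁
  have hL₁1 : 1 ≤ L₁ := le_max_left _ _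
  have hrec : ∀ L, L₁ ≤ L →
      f L ≤ C₁ * L ^ (-(5 / 8 : ℝ)) * S L ^ (3 / 4 : ℝ) + C₂ * Real.sqrt (S L) * L ^ (-(5 / 2 : ℝ)) := by
    intro L hLL
    have hL1 : 1 ≤ L := hL₁1.trans hLL
    have hL : 0 < L := by linarith
    have hR₁L : l * |R₁| ≤ L := (le_max_left _ _).trans ((le_max_right _ _).trans hLL)
    have hlL : l ≤ L := (le_max_left _ _).trans ((le_max_right _ _).trans ((le_max_right _ _).trans hLL))
    have hsL : l * Real.sqrt (b * -τ₀) ≤ L :=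
      (le_max_right _ _).trans ((le_max_right _ _).trans ((le_max_right _ _).trans hLL))
    have hR₁a := le_abs_self R₁
    have hSL0 : 0 ≤ S L := windowSum_nonneg hf0' (fun L => rfl) hL
    -- (i) slice by slice, the target shell sits in the shell of the slice inequality at scale `2L`
    have h2 := hK (2 * L) (by positivity)
    have h4 : 2 * (2 * L) / l ≤ L := by
      rw [div_le_iff₀ hl0]
      have := mul_le_mul_of_nonneg_left hl hL.le
      linarith
    have h1 : f L ≤ K / (2 * L) * ((∫ τ in I₀,
        ∫ y in {y : EuclideanSpace ℝ (Fin 3) | 2 * L ≤ ‖y‖ ∧ ‖y‖ ≤ 2 * (2 * L)},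
          (‖u τ y‖ ^ 3 + 2 * (|p τ y| * ‖u τ y‖))) +
        l * ∫ τ in I₀, ∫ y in {y : EuclideanSpace ℝ (Fin 3) | 2 * L / l ≤ ‖y‖ ∧ ‖y‖ ≤ 2 * (2 * L) / l},
          (‖u τ y‖ ^ 3 + 2 * (|p τ y| * ‖u τ y‖))) := by
      refine hfle L _ ?_
      filter_upwards [h2, hE] with τ hτ hEτ hτI
      obtain ⟨hi2, -⟩ := hEτ (hI₀0 hτI)
      refine le_trans ?_ (hτ hτI)
      exact setIntegral_mono_set hi2.integrableOn (Eventually.of_forall fun y => by positivity)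
        (Eventually.of_forall fun y hy => ⟨h4.trans hy.1, hy.2.le⟩)
    -- (ii) the two flux bounds
    have h4m : (4 : ℝ) ≤ 2 ^ m := by linarith [h2m]
    have h64 : 64 * L ≤ 2 ^ (m + 1) * L := mul_le_mul_of_nonneg_right h2m' hL.le
    have hsq0 : 0 ≤ Real.sqrt (b * -τ₀) := Real.sqrt_nonneg _
    have hsq2 : Real.sqrt (b * -τ₀) ^ 2 = b * -τ₀ := Real.sq_sqrt (mul_nonneg hb0.le (by linarith))
    have hα1 : -((32 * (2 * L)) ^ 2) ≤ b * τ₀ := by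
      have h1' : Real.sqrt (b * -τ₀) ≤ 32 * (2 * L) := by
        have : Real.sqrt (b * -τ₀) ≤ l * Real.sqrt (b * -τ₀) := le_mul_of_one_le_left hsq0 hl1.le
        linarith
      have h2' := pow_le_pow_left₀ hsq0 h1' 2
      rw [hsq2] at h2'
      linarith
    have hα2 : -((32 * (2 * L / l)) ^ 2) ≤ b * τ₀ := by
      have h1' : Real.sqrt (b * -τ₀) ≤ 32 * (2 * L / l) := by
        rw [show 32 * (2 * L / l) = 64 * L / l by ring, le_div_iff₀ hl0]
        linarith
      have h2' := pow_le_pow_left₀ hsq0 h1' 2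
      rw [hsq2] at h2'
      linarith
    have c0 : (1 : ℝ) ≤ 2 * L := by linarith
    have hR₁' : 1 * |R₁| ≤ l * |R₁| := mul_le_mul_of_nonneg_right hl1.le (abs_nonneg R₁)
    have c2 : R₁ ≤ 32 * (2 * L) := by linarith
    have c3 : L / 2 ^ m ≤ 2 * L / 8 := by
      rw [show 2 * L / 8 = L / 4 by ring]; exact div_le_div_of_nonneg_left hL.le (by norm_num) h4m
    have c4 : 32 * (2 * L) ≤ 2 ^ (m + 1) * L := by linarith
    have hX₁ := hQ L (2 * L) hL c0 hα1 c2 c3 c4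
    have d0 : (1 : ℝ) ≤ 2 * L / l := by
      rw [le_div_iff₀ hl0]; linarith
    have d2 : R₁ ≤ 32 * (2 * L / l) := by
      rw [show 32 * (2 * L / l) = 64 * L / l by ring, le_div_iff₀ hl0]
      have := mul_le_mul_of_nonneg_right hR₁a hl0.le
      linarith
    have d3 : L / 2 ^ m ≤ 2 * L / l / 8 := by
      rw [show 2 * L / l / 8 = L / (4 * l) by ring]
      exact div_le_div_of_nonneg_left hL.le (by positivity) h2m
    have d4 : 32 * (2 * L / l) ≤ 2 ^ (m + 1) * L := by
      rw [show 32 * (2 * L / l) = 64 * L / l by ring, div_le_iff₀ hl0]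
      have h64' : 2 ^ (m + 1) * L ≤ 2 ^ (m + 1) * L * l := le_mul_of_one_le_right (by positivity) hl1.le
      linarith
    have hX₂ := hQ L (2 * L / l) hL d0 hα2 d2 d3 d4
    have hset : {y : EuclideanSpace ℝ (Fin 3) | 2 * L / l ≤ ‖y‖ ∧ ‖y‖ ≤ 2 * (2 * L) / l} =
        {y : EuclideanSpace ℝ (Fin 3) | 2 * L / l ≤ ‖y‖ ∧ ‖y‖ ≤ 2 * (2 * L / l)} := by
      ext y; simp only [mem_setOf_eq, mul_div_assoc]
    rw [hset] at h1
    -- exponent bookkeeping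
    have hL38 : L ^ (3 / 8 : ℝ) = L ^ (-(5 / 8 : ℝ)) * L := by
      rw [show (3 / 8 : ℝ) = -(5 / 8 : ℝ) + 1 by norm_num, Real.rpow_add_one hL.ne']
    have hL52 : L ^ (-(3 / 2 : ℝ)) = L ^ (-(5 / 2 : ℝ)) * L := by
      rw [show (-(3 / 2 : ℝ)) = -(5 / 2 : ℝ) + 1 by norm_num, Real.rpow_add_one hL.ne']
    have hr1 : (2 * L) ^ (3 / 8 : ℝ) = (2 : ℝ) ^ (3 / 8 : ℝ) * (L ^ (-(5 / 8 : ℝ)) * L) := by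
      rw [Real.mul_rpow (by norm_num) hL.le, hL38]
    have hr2 : (2 * L / l) ^ (3 / 8 : ℝ) = (2 / l) ^ (3 / 8 : ℝ) * (L ^ (-(5 / 8 : ℝ)) * L) := by
      rw [show 2 * L / l = 2 / l * L by ring, Real.mul_rpow (by positivity) hL.le, hL38]
    have hr3 : (2 * L) ^ (-(3 / 2 : ℝ)) = (2 : ℝ) ^ (-(3 / 2 : ℝ)) * (L ^ (-(5 / 2 : ℝ)) * L) := by
      rw [Real.mul_rpow (by norm_num) hL.le, hL52]
    have hr4 : (2 * L / l) ^ (-(3 / 2 : ℝ)) = (2 / l) ^ (-(3 / 2 : ℝ)) * (L ^ (-(5 / 2 : ℝ)) * L) := by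
      rw [show 2 * L / l = 2 / l * L by ring, Real.mul_rpow (by positivity) hL.le, hL52]
    calc f L ≤ _ := h1
      _ ≤ K / (2 * L) * ((a * (2 * L) ^ (3 / 8 : ℝ) * S L ^ (3 / 4 : ℝ) +
              bb * (2 * L) ^ (-(3 / 2 : ℝ)) * E₀ * (T * Real.sqrt (S L))) +
            l * (a * (2 * L / l) ^ (3 / 8 : ℝ) * S L ^ (3 / 4 : ℝ) +
              bb * (2 * L / l) ^ (-(3 / 2 : ℝ)) * E₀ * (T * Real.sqrt (S L)))) :=
          mul_le_mul_of_nonneg_left (add_le_add hX₁ (mul_le_mul_of_nonneg_left hX₂ hl0.le))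
            (by positivity)
      _ = C₁ * L ^ (-(5 / 8 : ℝ)) * S L ^ (3 / 4 : ℝ) + C₂ * Real.sqrt (S L) * L ^ (-(5 / 2 : ℝ)) := by
          rw [hr1, hr2, hr3, hr4, hC₁, hC₂]
          field_simp
          ring
  -- iterate
  obtain ⟨C, hC⟩ := shell_decay_of_recursion_rpow (θ := 5 / 8) (q := 3 / 4) (κ := 5 / 2) hf0' hfB
    (by norm_num) (by norm_num) (by norm_num) (by norm_num) hC₁0 hC₂0
    (lt_of_lt_of_le one_pos hL₁1) (fun L => rfl) hrec hε
  have hC' : ∀ L, 1 ≤ L → f L ≤ C * L ^ (-(5 / 2 : ℝ) + ε) := by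
    intro L hL
    have := hC L hL
    norm_num at this ⊢
    exact this
  refine ⟨C, fun L hL => ⟨?_, ?_⟩⟩
  · filter_upwards [hfa L] with τ hτ hτI
    exact (hτ hτI).trans (hC' L hL)
  · obtain ⟨hi, -, -⟩ := hW _ (hshellm L (2 * L))
    calc (∫ τ in I₀, e L τ) ≤ ∫ τ in I₀, C * L ^ (-(5 / 2 : ℝ) + ε) :=
          setIntegral_mono_ae_restrict hi (integrable_const _)
            ((ae_restrict_iff' measurableSet_Ioo).2 (by
              filter_upwards [hfa L] with τ hτ hτI
              exact (hτ hτI).trans (hC' L hL)))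
      _ = T * (C * L ^ (-(5 / 2 : ℝ) + ε)) := by rw [setIntegral_const, hTvol, smul_eq_mul]

/-- **No DSS endpoint member (factor `l ≥ 4`) whose period-integrated shell energies are frequently
`≥ c₀ L^{−5+η}` with `η > 5/2` — no growth hypothesis.**  Under the hypotheses of
`dss_half_sliceEnergy_decay_of_weakGradient` and, for some `c₀ > 0`, `η > 5/2` and radii `L` beyond every
bound, `c₀ L^{−5+η} ≤ ∫_{(l^{5/2}τ₀, τ₀)} ∫_{L≤|y|<2L} |u(τ, y)|² dy dτ`: contradiction with the drain at
`ε = (η − 5/2)/2`. [cite: ChaeShvydkoy2013, §3.1 Thm. 3.1] -/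
theorem dss_half_period_false_of_shellLower_of_weakGradient_sharp {c : ℝ≥0}
    (hsw : IsSuitableWeakSolutionOn (slab (EuclideanSpace ℝ (Fin 3)) (Iio 0) isOpen_Iio) 0 0 u p)
    (hH : HasWeakSpatialGradientOn (slab (EuclideanSpace ℝ (Fin 3)) (Iio 0) isOpen_Iio) u H)
    (hEg : ∀ a : ℝ, 0 < a →
      ENNReal.ofReal (a ^ (1 / 2 : ℝ)) * cknE a (0 : ℝ × EuclideanSpace ℝ (Fin 3)) H ≤ (c : ℝ≥0∞))
    {l : ℝ} (hl : 4 ≤ l)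
    (hu : ∀ τ : ℝ, τ < 0 → ∀ y, u τ y = (l ^ (3 / 2 : ℝ)) • u (l ^ (5 / 2 : ℝ) * τ) (l • y))
    (hp : ∀ τ : ℝ, τ < 0 → ∀ y, p τ y = l ^ 3 * p (l ^ (5 / 2 : ℝ) * τ) (l • y))
    {τ₀ : ℝ} (hτ₀ : τ₀ < 0) {E₀ : ℝ}
    (hE : ∀ᵐ τ : ℝ, τ < 0 → Integrable (fun y => ‖u τ y‖ ^ 2) volume ∧ ∫ y, ‖u τ y‖ ^ 2 ≤ E₀)
    (h3 : ∀ᵐ τ : ℝ, τ < 0 → LocallyIntegrable (fun y => ‖u τ y‖ ^ 3) volume)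
    (hPV : ∀ᵐ τ : ℝ, τ < 0 → LocallyIntegrable (fun y => |p τ y| * ‖u τ y‖) volume)
    {R₁ : ℝ}
    (hPR : ∀ᵐ τ : ℝ, τ ∈ Ioo (l ^ (5 / 2 : ℝ) * τ₀) τ₀ → ∀ R : ℝ, R₁ ≤ R →
      ∀ᵐ y ∂volume, ‖y‖ < R / 2 →
        p τ y = rieszPressure ((ball (0 : EuclideanSpace ℝ (Fin 3)) R).indicator (u τ)) y +
          ∫ z in {z | R ≤ ‖z‖}, pressureKernel (y - z) (u τ z))
    {c₀ η : ℝ} (hc₀ : 0 < c₀) (hη : 5 / 2 < η)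
    (hlow : ∀ L₁ : ℝ, ∃ L : ℝ, L₁ ≤ L ∧
      c₀ * L ^ (-(5 : ℝ) + η) ≤
        ∫ τ in Ioo (l ^ (5 / 2 : ℝ) * τ₀) τ₀,
          ∫ y in {y : EuclideanSpace ℝ (Fin 3) | L ≤ ‖y‖ ∧ ‖y‖ < 2 * L}, ‖u τ y‖ ^ 2) : False := by
  -- adapted from this seat's `dss_half_period_false_of_shellLower_of_weakGradient` (rate 5/2 for 5/6)
  have hη' : 0 < η - 5 / 2 := by linarith
  obtain ⟨C, hC⟩ := dss_half_sliceEnergy_decay_of_weakGradient hsw hH hEg hl hu hp hτ₀ hE h3 hPV hPR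
    (half_pos hη')
  set T : ℝ := τ₀ - l ^ (5 / 2 : ℝ) * τ₀ with hT
  have hT0 : 0 < T := by
    have hb1 : (1 : ℝ) < l ^ (5 / 2 : ℝ) := Real.one_lt_rpow (by linarith) (by norm_num)
    have := mul_lt_mul_of_neg_right hb1 hτ₀
    rw [hT]; linarith
  have hkey : ∀ L : ℝ, 1 ≤ L →
      c₀ * L ^ (-(5 : ℝ) + η) ≤
        ∫ τ in Ioo (l ^ (5 / 2 : ℝ) * τ₀) τ₀,
          ∫ y in {y : EuclideanSpace ℝ (Fin 3) | L ≤ ‖y‖ ∧ ‖y‖ < 2 * L}, ‖u τ y‖ ^ 2 →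
      c₀ * L ^ ((η - 5 / 2) / 2) ≤ T * C := by
    intro L hL1 hL
    have hL0 : 0 < L := one_pos.trans_le hL1
    have h1 : c₀ * L ^ (-(5 : ℝ) + η) ≤ T * C * L ^ (-(5 / 2 : ℝ) + (η - 5 / 2) / 2) := by
      have := hL.trans (hC L hL1).2
      rw [← mul_assoc] at this
      exact this
    have h2 := mul_le_mul_of_nonneg_right h1 (Real.rpow_pos_of_pos hL0 (5 / 2 - (η - 5 / 2) / 2)).le
    have e1 : c₀ * L ^ (-(5 : ℝ) + η) * L ^ (5 / 2 - (η - 5 / 2) / 2) = c₀ * L ^ ((η - 5 / 2) / 2) := by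
      rw [mul_assoc, ← Real.rpow_add hL0]; ring_nf
    have e2 : T * C * L ^ (-(5 / 2 : ℝ) + (η - 5 / 2) / 2) * L ^ (5 / 2 - (η - 5 / 2) / 2) = T * C := by
      rw [mul_assoc, ← Real.rpow_add hL0,
        show -(5 / 2 : ℝ) + (η - 5 / 2) / 2 + (5 / 2 - (η - 5 / 2) / 2) = 0 by ring, Real.rpow_zero, mul_one]
    rwa [e1, e2] at h2
  have hev : ∀ᶠ L : ℝ in atTop, T * C / c₀ < L ^ ((η - 5 / 2) / 2) :=
    (tendsto_rpow_atTop (half_pos hη')).eventually_gt_atTop (T * C / c₀)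
  obtain ⟨L₁, hL₁⟩ := (hev.and (eventually_ge_atTop (1 : ℝ))).exists_forall_of_atTop
  obtain ⟨L, hLL₁, hL⟩ := hlow L₁
  have h := hkey L (hL₁ L hLL₁).2 hL
  have h' := (hL₁ L hLL₁).1
  rw [div_lt_iff₀ hc₀] at h'
  linarith [mul_comm c₀ (L ^ ((η - 5 / 2) / 2))]

end Decay

end EndpointSobolev

end Summit.NavierStokesRegularity.NavierStokesRegularity.Theorems.PowerGaugeEulerLiouville
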